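import Literature.NumberTheory.Rogawski1990.RankOneUnstableTransferNonsplitCMOfCore   -- ★ A-p19 (g22): `normOne_frame_of_mem_centralizer` (+ ★ `finCharpolyTwo_eq_of_frame`, frame algebra)
import Literature.NumberTheory.Rogawski1990.RankOneUnstableNormOneSequence              -- ★ p08: `exists_normOne_seq`
import Literature.NumberTheory.Automorphic.LocalUnitaryGroupCongr                      -- ★ `glDiagonal` cone
import HarnessLib

/-!
# The REGULAR LOCUS of an elliptic regular torus of `H_v = U(Φ₂) × U(Φ₁)` is DENSE (non-split unramified place)
# (Rogawski 1990, §3.6, Lemma 4.9.3; Labesse–Langlands 1979, §2)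

Topic `NumberTheory/Rogawski1990`; namespace `Literature.NumberTheory.Rogawski1990`.  THEOREMS ONLY (no definition, no named fact, no instance,
no notation, no `sorry`).  Cell `pub/hodgecm-mathlib`, crux H413 = stmt-HodgeConjecture-24833, road «R1LL-tree» (rank-one unstable transfer letter);
architect A-p16 (g27) RULING A-8 (b): the socket `hdense` of ★ F0P3-p01 (g13) `rankOneUnstable_core_inert_of_eventually` (`RankOneUnstableTransferInertCore`),
in that theorem's binder shapes (companion of `RankOneTorusStablePartner`, the socket `τ`).  Hand: F0P2-p01 (g10).
HONEST LABEL: HC_CM is proved only modulo the printed citations until rung 0 closes; this file is unconditional local algebra ∕ topology.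

THE PRINT.  [Rogawski1990, §4.9 Lemma 4.9.3 p. 56] ∕ [LabesseLanglands1979, §2]: the germ argument near a singular element `t` of the anisotropic torus
`T = Z(t₀) ≅ E¹ × E¹ (× E¹)` [Rogawski1990, §3.6 pp. 31–32] runs through REGULAR `t' → t`: the regular locus is dense in `T`.  Here: every `t ∈ Z(t₀)` is
framed by the eigenframe `P` of `t₀.1` with a norm-one diagonal `(τ₀ t, τ₁ t)` (★ `normOne_frame_of_mem_centralizer`); `t.1` is singular iff `τ₀ t = τ₁ t`;
the curve `z ↦ (P diag(z, 1) P⁻¹, 1)` (`σ(z) z = 1`) lies in `Z(t₀)`, and `t · (P diag(u_N, 1) P⁻¹, 1)` is regular and tends to `t` along the norm-one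
sequence `u_N → 1`, `u_N ≠ 1` of ★ `exists_normOne_seq` (read in `L_v = ∏_{w' ∣ v} L_{w'} ≃ L_w`, one place above `v`).

WHAT IS PROVED (`L` CM, `v` a finite place of `L⁺` with ONE place of `L` above it, `H_v` on the ★ `cmDatum` carriers, `t₀ ∈ H_v` with `t₀.1` regular and
an eigenframe `t₀.1·P = P·diag d`, `σ(dᵢ) dᵢ = 1` — the binders of ★ `rankOneUnstable_core_inert_of_eventually`):
* §1 `tendsto_conj_glDiagonal_two` — `P diag(z_N, 1) P⁻¹ → 1` in `GL₂` when `z_N → 1` and `z_N⁻¹ → 1` (units topology).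
* §2 `conj_glDiagonal_normOne_mem_local` ∕ `…_mem_centralizer` (the norm-one curve of the frame lies in `U(Φ₂)(L⁺_v)` and in `Z(t₀)`),
  `isRegularElt_mul_conj_glDiagonal_of_not_isRegularElt` (moving a singular `x` along the curve makes it regular).
* §3 **`dense_setOf_isRegularElt_centralizer`** — `Dense {t ∈ Z(t₀) | t.1 regular}` (`v` unramified in `L`).

## References
* [Rogawski1990] J. D. Rogawski, *Automorphic Representations of Unitary Groups in Three Variables*, Ann. of Math. Stud. 123 (1990): §3.6 pp. 31–32,
  §4.9 Lemma 4.9.3 p. 56.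
* [LabesseLanglands1979] J.-P. Labesse, R. P. Langlands, *L-indistinguishability for SL(2)*, Canad. J. Math. 31 (1979): §2.
* [BourbakiGT1] N. Bourbaki, *General Topology*, Ch. I §8.3, Ch. III §1.
-/

set_option autoImplicit false

noncomputable section

open Filter Topology NumberField IsDedekindDomain Polynomial Matrix
open scoped MatrixGroups

namespace Literature.NumberTheory.Rogawski1990

open Literature.NumberTheory.Automorphic Literature.NumberTheory.Automorphic.UnitaryGroup Literature.NumberTheory.GaloisRepresentations
open Literature.AlgebraicGeometry.ShimuraVarieties (unitaryGroup mem_unitaryGroup_iff)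

section Helpers

/-- `(X − a)(X − b)` separable ⇒ `a ≠ b`. [folklore] -/
private theorem ne_of_separable_X_sub_C_mul₁₀ {K : Type*} [Field K] {a b : K} (h : ((X - C a) * (X - C b)).Separable) : a ≠ b := by
  rintro rfl
  exact Polynomial.not_isUnit_X_sub_C a (isCoprime_self.1 h.isCoprime)

/-- `a ≠ b` ⇒ `(X − a)(X − b)` separable (over a field). [folklore] -/
private theorem separable_X_sub_C_mul_of_ne₁₀ {K : Type*} [Field K] {a b : K} (h : a ≠ b) : ((X - C a) * (X - C b)).Separable :=
  Polynomial.separable_X_sub_C.mul Polynomial.separable_X_sub_C (Polynomial.isCoprime_X_sub_C_of_isUnit_sub (sub_ne_zero.2 h).isUnit)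

/-- `![a, b]` is injective when `a ≠ b`. [folklore] -/
private theorem injective_vecCons_two₁₀ {K : Type*} {a b : K} (h : a ≠ b) : Function.Injective ![a, b] := by
  intro i j hij
  fin_cases i <;> fin_cases j
  · rfl
  · exact absurd hij h
  · exact absurd hij.symm h
  · rfl

/-- At a place with ONE prime of `L` above it, that prime is fixed by complex conjugation (local copy of ★ `smul_eq_of_subsingleton_placesOver`).
[cite: CasselsFrohlichANT1967, Ch. VII Prop. 1.2 (ii)] -/
private theorem smul_eq_of_subsingleton_placesOver₁₀ (L : Type) [Field L] [NumberField L] [IsCMField L] {v : HeightOneSpectrum (𝓞 ↥(maximalRealSubfield L))}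
    (hv : Subsingleton (PlacesOver L v)) (w : PlacesOver L v) :
    IsCMField.complexConj L • w.1 = w.1 := by
  have hmem : (IsCMField.complexConj L • w.1).under (𝓞 ↥(maximalRealSubfield L)) = v := by
    rw [HeightOneSpectrum.under_algEquiv_smul]; exact w.2
  exact congrArg Subtype.val (Subsingleton.elim (⟨IsCMField.complexConj L • w.1, hmem⟩ : PlacesOver L v) w)

end Helpers

section Density

/-! ## §1 Convergence of the norm-one curve in `GL₂` -/

/-- **`P · diag(z, σz) · P⁻¹ → 1` in `GL₂(R)`** when `z → 1` and its inverse `σz → 1` (the units topology: both the matrix and its inverse converge entrywise).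
[cite: BourbakiGT1, Ch. III §1] -/
theorem tendsto_conj_glDiagonal_two {R : Type*} [CommRing R] [TopologicalSpace R] [IsTopologicalRing R] (P : GL (Fin 2) R)
    {z zi : ℕ → R} (h1 : ∀ N, z N * zi N = 1) (h2 : ∀ N, zi N * z N = 1) (hz : Tendsto z atTop (𝓝 1)) (hzi : Tendsto zi atTop (𝓝 1)) :
    Tendsto (fun N => P * glDiagonal 2 R ![(⟨z N, zi N, h1 N, h2 N⟩ : Rˣ), 1] * P⁻¹) atTop (𝓝 1) := by
  have hdiag : Continuous fun A : Fin 2 → R => diagonal A := continuous_id.matrix_diagonal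
  have hval : Tendsto (fun N => (glDiagonal 2 R ![(⟨z N, zi N, h1 N, h2 N⟩ : Rˣ), 1]).val) atTop (𝓝 1) := by
    have hv : Tendsto (fun N => fun k : Fin 2 => ((![(⟨z N, zi N, h1 N, h2 N⟩ : Rˣ), 1] k : Rˣ) : R)) atTop (𝓝 fun _ => 1) := by
      rw [tendsto_pi_nhds]
      intro k
      fin_cases k
      · exact hz
      · exact tendsto_const_nhds
    have h := (hdiag.tendsto _).comp hv
    rw [Matrix.diagonal_one] at h
    exact h
  have hinv : Tendsto (fun N => ((glDiagonal 2 R ![(⟨z N, zi N, h1 N, h2 N⟩ : Rˣ), 1])⁻¹).val) atTop (𝓝 1) := by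
    have hv : Tendsto (fun N => fun k : Fin 2 => (((![(⟨z N, zi N, h1 N, h2 N⟩ : Rˣ), 1] k)⁻¹ : Rˣ) : R)) atTop (𝓝 fun _ => 1) := by
      rw [tendsto_pi_nhds]
      intro k
      fin_cases k
      · exact hzi
      · exact tendsto_const_nhds
    have h := (hdiag.tendsto _).comp hv
    rw [Matrix.diagonal_one] at h
    have heq : (fun N => ((glDiagonal 2 R ![(⟨z N, zi N, h1 N, h2 N⟩ : Rˣ), 1])⁻¹).val) =
        (fun A : Fin 2 → R => diagonal A) ∘ (fun N => fun k : Fin 2 => (((![(⟨z N, zi N, h1 N, h2 N⟩ : Rˣ), 1] k)⁻¹ : Rˣ) : R)) := by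
      funext N
      rw [← map_inv]
      rfl
    rw [heq]
    exact h
  have hD : Tendsto (fun N => glDiagonal 2 R ![(⟨z N, zi N, h1 N, h2 N⟩ : Rˣ), 1]) atTop (𝓝 1) := by
    rw [Units.isInducing_embedProduct.tendsto_nhds_iff]
    show Tendsto (fun N => ((glDiagonal 2 R ![(⟨z N, zi N, h1 N, h2 N⟩ : Rˣ), 1]).val,
        MulOpposite.op ((glDiagonal 2 R ![(⟨z N, zi N, h1 N, h2 N⟩ : Rˣ), 1])⁻¹).val)) atTop
      (𝓝 ((1 : GL (Fin 2) R).val, MulOpposite.op ((1 : GL (Fin 2) R)⁻¹).val))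
    rw [inv_one, Units.val_one, MulOpposite.op_one]
    exact hval.prodMk_nhds ((MulOpposite.continuous_op.tendsto (1 : Matrix (Fin 2) (Fin 2) R)).comp hinv)
  have h := ((tendsto_const_nhds (x := P)).mul hD).mul (tendsto_const_nhds (x := P⁻¹))
  rwa [mul_one, mul_inv_cancel] at h

variable (L : Type) [Field L] [NumberField L] [IsCMField L] (v : HeightOneSpectrum (𝓞 ↥(maximalRealSubfield L)))

/-! ## §2 The norm-one curve of the frame lies in the torus; moving a singular element along it makes it regular -/

/-- **THE NORM-ONE CURVE OF THE FRAME LIES IN `U(Φ₂)(L⁺_v)`**: if `t₀.1 ∈ U(Φ₂)(L⁺_v)` is regular with eigenframe `P` (norm-one eigenvalues), then for every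
`z` with `σ(z) z = 1` the element `P · diag(z, 1) · P⁻¹` is unitary — the Gram matrix of `Φ₂` in the frame `P` is DIAGONAL (★ `twistGram_eigenframe_eq_diagonal`),
and a norm-one diagonal preserves a diagonal hermitian form. [cite: Rogawski1990, §3.6 pp. 31–32] -/
theorem conj_glDiagonal_normOne_mem_local (w : PlacesOver L v) (hw : IsCMField.complexConj L • w.1 = w.1)
    (t₀ : ((cmDatum L 2 (Matrix.of fun i j : Fin 2 => if i.val + j.val + 1 = 2 then (1 : L) else 0)).Local v × (cmDatum L 1 (Matrix.of fun i j : Fin 1 => if i.val + j.val + 1 = 1 then (1 : L) else 0)).Local v)) (P : GL (Fin 2) (LocalRing L v)) (d : Fin 2 → (LocalRing L v)) (ht₀ : IsRegularElt (t₀.1.val : GL (Fin 2) (LocalRing L v)))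
    (hP : (t₀.1.val.val : Matrix (Fin 2) (Fin 2) (LocalRing L v)) * P.val = P.val * Matrix.diagonal d) (hd1 : ∀ i, conjLocal L (IsCMField.complexConj L) v (d i) * d i = 1)
    {z : LocalRing L v} (hz : conjLocal L (IsCMField.complexConj L) v z * z = 1) (hz' : z * conjLocal L (IsCMField.complexConj L) v z = 1) :
    (P * glDiagonal 2 (LocalRing L v) ![(⟨z, conjLocal L (IsCMField.complexConj L) v z, hz', hz⟩ : (LocalRing L v)ˣ), 1] * P⁻¹) ∈ («local» L (IsCMField.complexConj L) 2 (Matrix.of fun i j : Fin 2 => if i.val + j.val + 1 = 2 then (1 : L) else 0) v) := by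
  classical
  have hc1 : IsCMField.complexConj L ≠ 1 := IsCMField.complexConj_ne_one L
  letI : Field (LocalRing L v) := (LocalRing.isField_of_smul_eq (IsCMField.complexConj L) hc1 w hw).toField
  have hU : ∀ g : ((cmDatum L 2 (Matrix.of fun i j : Fin 2 => if i.val + j.val + 1 = 2 then (1 : L) else 0)).Local v), g.val ∈ unitaryGroup (conjLocal L (IsCMField.complexConj L) v) ((adelicForm L 2 (Matrix.of fun i j : Fin 2 => if i.val + j.val + 1 = 2 then (1 : L) else 0)).map (adeleToLocal L v)) :=
    fun g => (mem_unitaryGroup_iff (σ := (conjLocal L (IsCMField.complexConj L) v)) (H := ((adelicForm L 2 (Matrix.of fun i j : Fin 2 => if i.val + j.val + 1 = 2 then (1 : L) else 0)).map (adeleToLocal L v))) (g := g.val)).2 ((mem_unitaryGroupOfForm_iff (σ := (conjLocal L (IsCMField.complexConj L) v)) (J := ((adelicForm L 2 (Matrix.of fun i j : Fin 2 => if i.val + j.val + 1 = 2 then (1 : L) else 0)).map (adeleToLocal L v))) (g := g.val)).1 g.2)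
  -- `d` is injective (`t₀.1` regular), so the Gram matrix of `Φ₂` in the frame `P` is diagonal
  have hdinj : Function.Injective d := by
    have hdvec : d = ![d 0, d 1] := by funext i; fin_cases i <;> rfl
    have hχ : finCharpolyTwo L v t₀ = (X - C (d 0)) * (X - C (d 1)) := finCharpolyTwo_eq_of_frame P (by rw [← hdvec]; exact hP)
    have hsep : (finCharpolyTwo L v t₀).Separable := ht₀
    rw [hχ] at hsep
    rw [hdvec]
    exact injective_vecCons_two₁₀ (ne_of_separable_X_sub_C_mul₁₀ hsep)
  have hG := twistGram_eigenframe_eq_diagonal (conjLocal L (IsCMField.complexConj L) v) ((adelicForm L 2 (Matrix.of fun i j : Fin 2 => if i.val + j.val + 1 = 2 then (1 : L) else 0)).map (adeleToLocal L v)) (hU t₀.1) hP hdinj hd1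
  have hD : (((glDiagonal 2 (LocalRing L v) ![(⟨z, conjLocal L (IsCMField.complexConj L) v z, hz', hz⟩ : (LocalRing L v)ˣ), 1]).val.map (conjLocal L (IsCMField.complexConj L) v))ᵀ *
        (diagonal fun i => twistGram (conjLocal L (IsCMField.complexConj L) v) ((adelicForm L 2 (Matrix.of fun i j : Fin 2 => if i.val + j.val + 1 = 2 then (1 : L) else 0)).map (adeleToLocal L v)) P.val i i)) * (glDiagonal 2 (LocalRing L v) ![(⟨z, conjLocal L (IsCMField.complexConj L) v z, hz', hz⟩ : (LocalRing L v)ˣ), 1]).val =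
      diagonal fun i => twistGram (conjLocal L (IsCMField.complexConj L) v) ((adelicForm L 2 (Matrix.of fun i j : Fin 2 => if i.val + j.val + 1 = 2 then (1 : L) else 0)).map (adeleToLocal L v)) P.val i i := by
    rw [coe_glDiagonal, diagonal_map (map_zero _), diagonal_transpose, diagonal_mul_diagonal, diagonal_mul_diagonal]
    congr 1
    funext i
    fin_cases i
    · show conjLocal L (IsCMField.complexConj L) v z * twistGram (conjLocal L (IsCMField.complexConj L) v) ((adelicForm L 2 (Matrix.of fun i j : Fin 2 => if i.val + j.val + 1 = 2 then (1 : L) else 0)).map (adeleToLocal L v)) P.val 0 0 * z = twistGram (conjLocal L (IsCMField.complexConj L) v) ((adelicForm L 2 (Matrix.of fun i j : Fin 2 => if i.val + j.val + 1 = 2 then (1 : L) else 0)).map (adeleToLocal L v)) P.val 0 0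
      rw [mul_right_comm, hz, one_mul]
    · show conjLocal L (IsCMField.complexConj L) v 1 * twistGram (conjLocal L (IsCMField.complexConj L) v) ((adelicForm L 2 (Matrix.of fun i j : Fin 2 => if i.val + j.val + 1 = 2 then (1 : L) else 0)).map (adeleToLocal L v)) P.val 1 1 * 1 = twistGram (conjLocal L (IsCMField.complexConj L) v) ((adelicForm L 2 (Matrix.of fun i j : Fin 2 => if i.val + j.val + 1 = 2 then (1 : L) else 0)).map (adeleToLocal L v)) P.val 1 1
      rw [map_one, one_mul, mul_one]
  refine (mem_unitaryGroupOfForm_iff (σ := (conjLocal L (IsCMField.complexConj L) v)) (J := ((adelicForm L 2 (Matrix.of fun i j : Fin 2 => if i.val + j.val + 1 = 2 then (1 : L) else 0)).map (adeleToLocal L v))) (g := (P * glDiagonal 2 (LocalRing L v) ![(⟨z, conjLocal L (IsCMField.complexConj L) v z, hz', hz⟩ : (LocalRing L v)ˣ), 1] * P⁻¹))).2 ?_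
  change twistGram (conjLocal L (IsCMField.complexConj L) v) ((adelicForm L 2 (Matrix.of fun i j : Fin 2 => if i.val + j.val + 1 = 2 then (1 : L) else 0)).map (adeleToLocal L v)) (P * glDiagonal 2 (LocalRing L v) ![(⟨z, conjLocal L (IsCMField.complexConj L) v z, hz', hz⟩ : (LocalRing L v)ˣ), 1] * P⁻¹).val = ((adelicForm L 2 (Matrix.of fun i j : Fin 2 => if i.val + j.val + 1 = 2 then (1 : L) else 0)).map (adeleToLocal L v))
  rw [Units.val_mul, Units.val_mul, twistGram_mul, twistGram_mul, hG, hD, ← hG, ← twistGram_mul, ← Units.val_mul, mul_inv_cancel,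
    Units.val_one, twistGram_one]

/-- **… AND IN THE TORUS `Z(t₀)`**: `(P · diag(z, 1) · P⁻¹, 1)` commutes with `t₀ = (P · diag(d) · P⁻¹, t₀.2)` (diagonal matrices commute).
[cite: Rogawski1990, §3.6 pp. 31–32] -/
theorem conj_glDiagonal_normOne_mem_centralizer (w : PlacesOver L v) (hw : IsCMField.complexConj L • w.1 = w.1)
    (t₀ : ((cmDatum L 2 (Matrix.of fun i j : Fin 2 => if i.val + j.val + 1 = 2 then (1 : L) else 0)).Local v × (cmDatum L 1 (Matrix.of fun i j : Fin 1 => if i.val + j.val + 1 = 1 then (1 : L) else 0)).Local v)) (P : GL (Fin 2) (LocalRing L v)) (d : Fin 2 → (LocalRing L v)) (ht₀ : IsRegularElt (t₀.1.val : GL (Fin 2) (LocalRing L v)))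
    (hP : (t₀.1.val.val : Matrix (Fin 2) (Fin 2) (LocalRing L v)) * P.val = P.val * Matrix.diagonal d) (hd1 : ∀ i, conjLocal L (IsCMField.complexConj L) v (d i) * d i = 1)
    {z : LocalRing L v} (hz : conjLocal L (IsCMField.complexConj L) v z * z = 1) (hz' : z * conjLocal L (IsCMField.complexConj L) v z = 1) :
    (((⟨(P * glDiagonal 2 (LocalRing L v) ![(⟨z, conjLocal L (IsCMField.complexConj L) v z, hz', hz⟩ : (LocalRing L v)ˣ), 1] * P⁻¹), conj_glDiagonal_normOne_mem_local L v w hw t₀ P d ht₀ hP hd1 hz hz'⟩ : ((cmDatum L 2 (Matrix.of fun i j : Fin 2 => if i.val + j.val + 1 = 2 then (1 : L) else 0)).Local v)), (1 : ((cmDatum L 1 (Matrix.of fun i j : Fin 1 => if i.val + j.val + 1 = 1 then (1 : L) else 0)).Local v))) : ((cmDatum L 2 (Matrix.of fun i j : Fin 2 => if i.val + j.val + 1 = 2 then (1 : L) else 0)).Local v × (cmDatum L 1 (Matrix.of fun i j : Fin 1 => if i.val + j.val + 1 = 1 then (1 : L) else 0)).Local v)) ∈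
      Subgroup.centralizer ({t₀} : Set ((cmDatum L 2 (Matrix.of fun i j : Fin 2 => if i.val + j.val + 1 = 2 then (1 : L) else 0)).Local v × (cmDatum L 1 (Matrix.of fun i j : Fin 1 => if i.val + j.val + 1 = 1 then (1 : L) else 0)).Local v)) := by
  have hPP : P.val * (P⁻¹).val = 1 := by rw [← Units.val_mul, mul_inv_cancel, Units.val_one]
  have hPiP : (P⁻¹).val * P.val = 1 := by rw [← Units.val_mul, inv_mul_cancel, Units.val_one]
  have hPinv : (P⁻¹).val * (t₀.1.val.val : Matrix (Fin 2) (Fin 2) (LocalRing L v)) = Matrix.diagonal d * (P⁻¹).val := by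
    calc (P⁻¹).val * (t₀.1.val.val : Matrix (Fin 2) (Fin 2) (LocalRing L v))
        = (P⁻¹).val * ((t₀.1.val.val : Matrix (Fin 2) (Fin 2) (LocalRing L v)) * (P.val * (P⁻¹).val)) := by rw [hPP, Matrix.mul_one]
      _ = (P⁻¹).val * ((t₀.1.val.val : Matrix (Fin 2) (Fin 2) (LocalRing L v)) * P.val) * (P⁻¹).val := by simp only [Matrix.mul_assoc]
      _ = (P⁻¹).val * (P.val * Matrix.diagonal d) * (P⁻¹).val := by rw [hP]
      _ = Matrix.diagonal d * (P⁻¹).val := by rw [← Matrix.mul_assoc, hPiP, Matrix.one_mul]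
  have hDd : (glDiagonal 2 (LocalRing L v) ![(⟨z, conjLocal L (IsCMField.complexConj L) v z, hz', hz⟩ : (LocalRing L v)ˣ), 1]).val * Matrix.diagonal d = Matrix.diagonal d * (glDiagonal 2 (LocalRing L v) ![(⟨z, conjLocal L (IsCMField.complexConj L) v z, hz', hz⟩ : (LocalRing L v)ˣ), 1]).val := by
    rw [coe_glDiagonal, diagonal_mul_diagonal, diagonal_mul_diagonal]
    congr 1
    funext i
    exact mul_comm _ _
  rw [Subgroup.mem_centralizer_singleton_iff]
  refine Prod.ext (Subtype.ext (Units.ext ?_)) ?_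
  · show ((P * glDiagonal 2 (LocalRing L v) ![(⟨z, conjLocal L (IsCMField.complexConj L) v z, hz', hz⟩ : (LocalRing L v)ˣ), 1] * P⁻¹) * t₀.1.val).val = (t₀.1.val * (P * glDiagonal 2 (LocalRing L v) ![(⟨z, conjLocal L (IsCMField.complexConj L) v z, hz', hz⟩ : (LocalRing L v)ˣ), 1] * P⁻¹)).val
    rw [Units.val_mul, Units.val_mul, Units.val_mul, Units.val_mul, Units.val_mul]
    calc P.val * (glDiagonal 2 (LocalRing L v) ![(⟨z, conjLocal L (IsCMField.complexConj L) v z, hz', hz⟩ : (LocalRing L v)ˣ), 1]).val * (P⁻¹).val * (t₀.1.val.val : Matrix (Fin 2) (Fin 2) (LocalRing L v))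
        = P.val * (glDiagonal 2 (LocalRing L v) ![(⟨z, conjLocal L (IsCMField.complexConj L) v z, hz', hz⟩ : (LocalRing L v)ˣ), 1]).val * ((P⁻¹).val * (t₀.1.val.val : Matrix (Fin 2) (Fin 2) (LocalRing L v))) := by
          simp only [Matrix.mul_assoc]
      _ = P.val * ((glDiagonal 2 (LocalRing L v) ![(⟨z, conjLocal L (IsCMField.complexConj L) v z, hz', hz⟩ : (LocalRing L v)ˣ), 1]).val * Matrix.diagonal d) * (P⁻¹).val := by rw [hPinv]; simp only [Matrix.mul_assoc]
      _ = P.val * (Matrix.diagonal d * (glDiagonal 2 (LocalRing L v) ![(⟨z, conjLocal L (IsCMField.complexConj L) v z, hz', hz⟩ : (LocalRing L v)ˣ), 1]).val) * (P⁻¹).val := by rw [hDd]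
      _ = (P.val * Matrix.diagonal d) * (glDiagonal 2 (LocalRing L v) ![(⟨z, conjLocal L (IsCMField.complexConj L) v z, hz', hz⟩ : (LocalRing L v)ˣ), 1]).val * (P⁻¹).val := by simp only [Matrix.mul_assoc]
      _ = (t₀.1.val.val : Matrix (Fin 2) (Fin 2) (LocalRing L v)) * (P.val * (glDiagonal 2 (LocalRing L v) ![(⟨z, conjLocal L (IsCMField.complexConj L) v z, hz', hz⟩ : (LocalRing L v)ˣ), 1]).val * (P⁻¹).val) := by
          rw [← hP]; simp only [Matrix.mul_assoc]
  · show (1 : ((cmDatum L 1 (Matrix.of fun i j : Fin 1 => if i.val + j.val + 1 = 1 then (1 : L) else 0)).Local v)) * t₀.2 = t₀.2 * 1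
    rw [one_mul, mul_one]

/-- **MOVING A SINGULAR TORUS ELEMENT ALONG THE NORM-ONE CURVE MAKES IT REGULAR**: if `x ∈ Z(t₀)` has `x.1` NOT regular (its two eigenvalues `τ₀ x = τ₁ x`
coincide) and `z ≠ 1`, then `(x.1 · P diag(z, 1) P⁻¹)` has the distinct eigenvalues `(τ₀ x · z, τ₀ x)`, so it is regular (★ `finCharpolyTwo_eq_of_frame`).
[cite: Rogawski1990, §3.6 pp. 31–32; §4.9 Lemma 4.9.3 p. 56] [cite: LabesseLanglands1979, §2] -/
theorem isRegularElt_mul_conj_glDiagonal_of_not_isRegularElt (w : PlacesOver L v) (hw : IsCMField.complexConj L • w.1 = w.1)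
    (t₀ : ((cmDatum L 2 (Matrix.of fun i j : Fin 2 => if i.val + j.val + 1 = 2 then (1 : L) else 0)).Local v × (cmDatum L 1 (Matrix.of fun i j : Fin 1 => if i.val + j.val + 1 = 1 then (1 : L) else 0)).Local v)) (P : GL (Fin 2) (LocalRing L v)) (d : Fin 2 → (LocalRing L v)) (ht₀ : IsRegularElt (t₀.1.val : GL (Fin 2) (LocalRing L v)))
    (hP : (t₀.1.val.val : Matrix (Fin 2) (Fin 2) (LocalRing L v)) * P.val = P.val * Matrix.diagonal d) (hd1 : ∀ i, conjLocal L (IsCMField.complexConj L) v (d i) * d i = 1)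
    {z : LocalRing L v} (hz : conjLocal L (IsCMField.complexConj L) v z * z = 1) (hz' : z * conjLocal L (IsCMField.complexConj L) v z = 1) (hz1 : z ≠ 1)
    (x : ↥(Subgroup.centralizer ({t₀} : Set ((cmDatum L 2 (Matrix.of fun i j : Fin 2 => if i.val + j.val + 1 = 2 then (1 : L) else 0)).Local v × (cmDatum L 1 (Matrix.of fun i j : Fin 1 => if i.val + j.val + 1 = 1 then (1 : L) else 0)).Local v)))) (hx : ¬ IsRegularElt ((x : ((cmDatum L 2 (Matrix.of fun i j : Fin 2 => if i.val + j.val + 1 = 2 then (1 : L) else 0)).Local v × (cmDatum L 1 (Matrix.of fun i j : Fin 1 => if i.val + j.val + 1 = 1 then (1 : L) else 0)).Local v)).1.val : GL (Fin 2) (LocalRing L v))) :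
    IsRegularElt (((x : ((cmDatum L 2 (Matrix.of fun i j : Fin 2 => if i.val + j.val + 1 = 2 then (1 : L) else 0)).Local v × (cmDatum L 1 (Matrix.of fun i j : Fin 1 => if i.val + j.val + 1 = 1 then (1 : L) else 0)).Local v)) * (((⟨(P * glDiagonal 2 (LocalRing L v) ![(⟨z, conjLocal L (IsCMField.complexConj L) v z, hz', hz⟩ : (LocalRing L v)ˣ), 1] * P⁻¹), conj_glDiagonal_normOne_mem_local L v w hw t₀ P d ht₀ hP hd1 hz hz'⟩ : ((cmDatum L 2 (Matrix.of fun i j : Fin 2 => if i.val + j.val + 1 = 2 then (1 : L) else 0)).Local v)), (1 : ((cmDatum L 1 (Matrix.of fun i j : Fin 1 => if i.val + j.val + 1 = 1 then (1 : L) else 0)).Local v))) : ((cmDatum L 2 (Matrix.of fun i j : Fin 2 => if i.val + j.val + 1 = 2 then (1 : L) else 0)).Local v × (cmDatum L 1 (Matrix.of fun i j : Fin 1 => if i.val + j.val + 1 = 1 then (1 : L) else 0)).Local v))).1.val :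
      GL (Fin 2) (LocalRing L v)) := by
  classical
  have hc1 : IsCMField.complexConj L ≠ 1 := IsCMField.complexConj_ne_one L
  letI : Field (LocalRing L v) := (LocalRing.isField_of_smul_eq (IsCMField.complexConj L) hc1 w hw).toField
  have hPiP : (P⁻¹).val * P.val = 1 := by rw [← Units.val_mul, inv_mul_cancel, Units.val_one]
  -- the frame of `x`: equal eigenvalues `a = b` (non-regular), of norm one
  obtain ⟨hn1, hPx⟩ := normOne_frame_of_mem_centralizer L v w hw t₀ P d ht₀ hP hd1 _ x.2
  have ha0 : ((P⁻¹).val * ((x : ((cmDatum L 2 (Matrix.of fun i j : Fin 2 => if i.val + j.val + 1 = 2 then (1 : L) else 0)).Local v × (cmDatum L 1 (Matrix.of fun i j : Fin 1 => if i.val + j.val + 1 = 1 then (1 : L) else 0)).Local v)).1.val.val : Matrix (Fin 2) (Fin 2) (LocalRing L v)) * P.val) 0 0 ≠ 0 := by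
    have h := hn1 0
    exact right_ne_zero_of_mul_eq_one h
  have hab : ((P⁻¹).val * ((x : ((cmDatum L 2 (Matrix.of fun i j : Fin 2 => if i.val + j.val + 1 = 2 then (1 : L) else 0)).Local v × (cmDatum L 1 (Matrix.of fun i j : Fin 1 => if i.val + j.val + 1 = 1 then (1 : L) else 0)).Local v)).1.val.val : Matrix (Fin 2) (Fin 2) (LocalRing L v)) * P.val) 0 0 =
      ((P⁻¹).val * ((x : ((cmDatum L 2 (Matrix.of fun i j : Fin 2 => if i.val + j.val + 1 = 2 then (1 : L) else 0)).Local v × (cmDatum L 1 (Matrix.of fun i j : Fin 1 => if i.val + j.val + 1 = 1 then (1 : L) else 0)).Local v)).1.val.val : Matrix (Fin 2) (Fin 2) (LocalRing L v)) * P.val) 1 1 := by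
    by_contra hne
    have hχ := finCharpolyTwo_eq_of_frame P hPx
    apply hx
    show (finCharpolyTwo L v (x : ((cmDatum L 2 (Matrix.of fun i j : Fin 2 => if i.val + j.val + 1 = 2 then (1 : L) else 0)).Local v × (cmDatum L 1 (Matrix.of fun i j : Fin 1 => if i.val + j.val + 1 = 1 then (1 : L) else 0)).Local v))).Separable
    rw [hχ]
    exact separable_X_sub_C_mul_of_ne₁₀ hne
  -- the frame of `x · P diag(z, 1) P⁻¹`
  have hDx : Matrix.diagonal ![((P⁻¹).val * ((x : ((cmDatum L 2 (Matrix.of fun i j : Fin 2 => if i.val + j.val + 1 = 2 then (1 : L) else 0)).Local v × (cmDatum L 1 (Matrix.of fun i j : Fin 1 => if i.val + j.val + 1 = 1 then (1 : L) else 0)).Local v)).1.val.val : Matrix (Fin 2) (Fin 2) (LocalRing L v)) * P.val) 0 0, ((P⁻¹).val * ((x : ((cmDatum L 2 (Matrix.of fun i j : Fin 2 => if i.val + j.val + 1 = 2 then (1 : L) else 0)).Local v × (cmDatum L 1 (Matrix.of fun i j : Fin 1 => if i.val + j.val + 1 = 1 then (1 : L) else 0)).Local v)).1.val.val : Matrix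 (Fin 2) (Fin 2) (LocalRing L v)) * P.val) 1 1] * (glDiagonal 2 (LocalRing L v) ![(⟨z, conjLocal L (IsCMField.complexConj L) v z, hz', hz⟩ : (LocalRing L v)ˣ), 1]).val =
      Matrix.diagonal ![((P⁻¹).val * ((x : ((cmDatum L 2 (Matrix.of fun i j : Fin 2 => if i.val + j.val + 1 = 2 then (1 : L) else 0)).Local v × (cmDatum L 1 (Matrix.of fun i j : Fin 1 => if i.val + j.val + 1 = 1 then (1 : L) else 0)).Local v)).1.val.val : Matrix (Fin 2) (Fin 2) (LocalRing L v)) * P.val) 0 0 * z,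
        ((P⁻¹).val * ((x : ((cmDatum L 2 (Matrix.of fun i j : Fin 2 => if i.val + j.val + 1 = 2 then (1 : L) else 0)).Local v × (cmDatum L 1 (Matrix.of fun i j : Fin 1 => if i.val + j.val + 1 = 1 then (1 : L) else 0)).Local v)).1.val.val : Matrix (Fin 2) (Fin 2) (LocalRing L v)) * P.val) 1 1 * 1] := by
    rw [coe_glDiagonal, diagonal_mul_diagonal]
    congr 1
    funext i
    fin_cases i <;> rfl
  have hframe : (((x : ((cmDatum L 2 (Matrix.of fun i j : Fin 2 => if i.val + j.val + 1 = 2 then (1 : L) else 0)).Local v × (cmDatum L 1 (Matrix.of fun i j : Fin 1 => if i.val + j.val + 1 = 1 then (1 : L) else 0)).Local v)) * (((⟨(P * glDiagonal 2 (LocalRing L v) ![(⟨z, conjLocal L (IsCMField.complexConj L) v z, hz', hz⟩ : (LocalRing L v)ˣ), 1] * P⁻¹), conj_glDiagonal_normOne_mem_local L v w hw t₀ P d ht₀ hP hd1 hz hz'⟩ : ((cmDatum L 2 (Matrix.of fun i j : Fin 2 => if i.val + j.val + 1 = 2 then (1 : L) else 0)).Local v)), (1 : ((cmDatum L 1 (Matrix.of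 fun i j : Fin 1 => if i.val + j.val + 1 = 1 then (1 : L) else 0)).Local v))) : ((cmDatum L 2 (Matrix.of fun i j : Fin 2 => if i.val + j.val + 1 = 2 then (1 : L) else 0)).Local v × (cmDatum L 1 (Matrix.of fun i j : Fin 1 => if i.val + j.val + 1 = 1 then (1 : L) else 0)).Local v))).1.val.val :
        Matrix (Fin 2) (Fin 2) (LocalRing L v)) * P.val =
      P.val * Matrix.diagonal ![((P⁻¹).val * ((x : ((cmDatum L 2 (Matrix.of fun i j : Fin 2 => if i.val + j.val + 1 = 2 then (1 : L) else 0)).Local v × (cmDatum L 1 (Matrix.of fun i j : Fin 1 => if i.val + j.val + 1 = 1 then (1 : L) else 0)).Local v)).1.val.val : Matrix (Fin 2) (Fin 2) (LocalRing L v)) * P.val) 0 0 * z,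
        ((P⁻¹).val * ((x : ((cmDatum L 2 (Matrix.of fun i j : Fin 2 => if i.val + j.val + 1 = 2 then (1 : L) else 0)).Local v × (cmDatum L 1 (Matrix.of fun i j : Fin 1 => if i.val + j.val + 1 = 1 then (1 : L) else 0)).Local v)).1.val.val : Matrix (Fin 2) (Fin 2) (LocalRing L v)) * P.val) 1 1 * 1] := by
    show ((x : ((cmDatum L 2 (Matrix.of fun i j : Fin 2 => if i.val + j.val + 1 = 2 then (1 : L) else 0)).Local v × (cmDatum L 1 (Matrix.of fun i j : Fin 1 => if i.val + j.val + 1 = 1 then (1 : L) else 0)).Local v)).1.val * (P * glDiagonal 2 (LocalRing L v) ![(⟨z, conjLocal L (IsCMField.complexConj L) v z, hz', hz⟩ : (LocalRing L v)ˣ), 1] * P⁻¹)).val * P.val = _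
    rw [Units.val_mul, Units.val_mul, Units.val_mul, ← hDx]
    calc ((x : ((cmDatum L 2 (Matrix.of fun i j : Fin 2 => if i.val + j.val + 1 = 2 then (1 : L) else 0)).Local v × (cmDatum L 1 (Matrix.of fun i j : Fin 1 => if i.val + j.val + 1 = 1 then (1 : L) else 0)).Local v)).1.val.val : Matrix (Fin 2) (Fin 2) (LocalRing L v)) * (P.val * (glDiagonal 2 (LocalRing L v) ![(⟨z, conjLocal L (IsCMField.complexConj L) v z, hz', hz⟩ : (LocalRing L v)ˣ), 1]).val * (P⁻¹).val) * P.val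
        = (((x : ((cmDatum L 2 (Matrix.of fun i j : Fin 2 => if i.val + j.val + 1 = 2 then (1 : L) else 0)).Local v × (cmDatum L 1 (Matrix.of fun i j : Fin 1 => if i.val + j.val + 1 = 1 then (1 : L) else 0)).Local v)).1.val.val : Matrix (Fin 2) (Fin 2) (LocalRing L v)) * P.val) * (glDiagonal 2 (LocalRing L v) ![(⟨z, conjLocal L (IsCMField.complexConj L) v z, hz', hz⟩ : (LocalRing L v)ˣ), 1]).val * ((P⁻¹).val * P.val) := by
          simp only [Matrix.mul_assoc]
      _ = P.val * Matrix.diagonal ![((P⁻¹).val * ((x : ((cmDatum L 2 (Matrix.of fun i j : Fin 2 => if i.val + j.val + 1 = 2 then (1 : L) else 0)).Local v × (cmDatum L 1 (Matrix.of fun i j : Fin 1 => if i.val + j.val + 1 = 1 then (1 : L) else 0)).Local v)).1.val.val : Matrix (Fin 2) (Fin 2) (LocalRing L v)) * P.val) 0 0, ((P⁻¹).val * ((x : ((cmDatum L 2 (Matrix.of fun i j : Fin 2 => if i.val + j.val + 1 = 2 then (1 : L) else 0)).Local v × (cmDatum L 1 (Matrix.of fun i j : Fin 1 => if i.val + j.val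 + 1 = 1 then (1 : L) else 0)).Local v)).1.val.val : Matrix (Fin 2) (Fin 2) (LocalRing L v)) * P.val) 1 1] * (glDiagonal 2 (LocalRing L v) ![(⟨z, conjLocal L (IsCMField.complexConj L) v z, hz', hz⟩ : (LocalRing L v)ˣ), 1]).val := by rw [hPx, hPiP, Matrix.mul_one]
      _ = P.val * (Matrix.diagonal ![((P⁻¹).val * ((x : ((cmDatum L 2 (Matrix.of fun i j : Fin 2 => if i.val + j.val + 1 = 2 then (1 : L) else 0)).Local v × (cmDatum L 1 (Matrix.of fun i j : Fin 1 => if i.val + j.val + 1 = 1 then (1 : L) else 0)).Local v)).1.val.val : Matrix (Fin 2) (Fin 2) (LocalRing L v)) * P.val) 0 0, ((P⁻¹).val * ((x : ((cmDatum L 2 (Matrix.of fun i j : Fin 2 => if i.val + j.val + 1 = 2 then (1 : L) else 0)).Local v × (cmDatum L 1 (Matrix.of fun i j : Fin 1 => if i.val + j.val + 1 = 1 then (1 : L) else 0)).Local v)).1.val.val : Matrix (Fin 2) (Fin 2) (LocalRing L v)) * P.val) 1 1] * (glDiagonal 2 (LocalRing L v) ![(⟨z, conjLocal L (IsCMField.complexConj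 L) v z, hz', hz⟩ : (LocalRing L v)ˣ), 1]).val) := Matrix.mul_assoc _ _ _
  have hχ := finCharpolyTwo_eq_of_frame P hframe
  show (finCharpolyTwo L v ((x : ((cmDatum L 2 (Matrix.of fun i j : Fin 2 => if i.val + j.val + 1 = 2 then (1 : L) else 0)).Local v × (cmDatum L 1 (Matrix.of fun i j : Fin 1 => if i.val + j.val + 1 = 1 then (1 : L) else 0)).Local v)) * (((⟨(P * glDiagonal 2 (LocalRing L v) ![(⟨z, conjLocal L (IsCMField.complexConj L) v z, hz', hz⟩ : (LocalRing L v)ˣ), 1] * P⁻¹), conj_glDiagonal_normOne_mem_local L v w hw t₀ P d ht₀ hP hd1 hz hz'⟩ : ((cmDatum L 2 (Matrix.of fun i j : Fin 2 => if i.val + j.val + 1 = 2 then (1 : L) else 0)).Local v)), (1 : ((cmDatum L 1 (Matrix.of fun i j : Fin 1 => if i.val + j.val + 1 = 1 then (1 : L) else 0)).Local v))) : ((cmDatum L 2 (Matrix.of fun i j : Fin 2 => if i.val + j.val + 1 = 2 then (1 : L) else 0)).Local v × (cmDatum L 1 (Matrix.of fun i j : Fin 1 => if i.val + j.val + 1 =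 1 then (1 : L) else 0)).Local v)))).Separable
  rw [hχ]
  refine separable_X_sub_C_mul_of_ne₁₀ fun h => hz1 ?_
  rw [mul_one, ← hab] at h
  exact mul_left_cancel₀ ha0 (h.trans (mul_one _).symm)

/-! ## §3 The regular locus is dense in the torus `Z(t₀)` -/

/-- **THE REGULAR LOCUS IS DENSE IN AN ELLIPTIC REGULAR TORUS OF `H_v`** (socket `hdense` of ★ `rankOneUnstable_core_inert_of_eventually`; `v` non-split and
unramified in `L`).  For `t₀ ∈ H_v` with `t₀.1` regular and an eigenframe `t₀.1·P = P·diag d`, `σ(dᵢ) dᵢ = 1`, the set `{t ∈ Z(t₀) | t.1 regular}` is dense in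
`Z(t₀)`: a singular `x ∈ Z(t₀)` (`τ₀ x = τ₁ x`) is the limit of the REGULAR `x · (P diag(u_N, 1) P⁻¹, 1) ∈ Z(t₀)` along the norm-one sequence `u_N → 1`,
`u_N ≠ 1` of ★ `exists_normOne_seq` (read in `L_v = ∏_{w' ∣ v} L_{w'} ≃ L_w`, one place above `v`).
[cite: Rogawski1990, §3.6 pp. 31–32; §4.9 Lemma 4.9.3 p. 56] [cite: LabesseLanglands1979, §2] [cite: BourbakiGT1, Ch. I §8.3] -/
theorem dense_setOf_isRegularElt_centralizer (hv : Subsingleton (PlacesOver L v)) (hunr : Algebra.IsUnramifiedIn (𝓞 L) v.asIdeal)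
    (t₀ : ((cmDatum L 2 (Matrix.of fun i j : Fin 2 => if i.val + j.val + 1 = 2 then (1 : L) else 0)).Local v × (cmDatum L 1 (Matrix.of fun i j : Fin 1 => if i.val + j.val + 1 = 1 then (1 : L) else 0)).Local v)) (P : GL (Fin 2) (LocalRing L v)) (d : Fin 2 → (LocalRing L v)) (ht₀ : IsRegularElt (t₀.1.val : GL (Fin 2) (LocalRing L v)))
    (hP : (t₀.1.val.val : Matrix (Fin 2) (Fin 2) (LocalRing L v)) * P.val = P.val * Matrix.diagonal d) (hd1 : ∀ i, conjLocal L (IsCMField.complexConj L) v (d i) * d i = 1) :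
    Dense {t : ↥(Subgroup.centralizer ({t₀} : Set ((cmDatum L 2 (Matrix.of fun i j : Fin 2 => if i.val + j.val + 1 = 2 then (1 : L) else 0)).Local v × (cmDatum L 1 (Matrix.of fun i j : Fin 1 => if i.val + j.val + 1 = 1 then (1 : L) else 0)).Local v))) | IsRegularElt ((t : ((cmDatum L 2 (Matrix.of fun i j : Fin 2 => if i.val + j.val + 1 = 2 then (1 : L) else 0)).Local v × (cmDatum L 1 (Matrix.of fun i j : Fin 1 => if i.val + j.val + 1 = 1 then (1 : L) else 0)).Local v)).1.val : GL (Fin 2) (LocalRing L v))} := by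
  classical
  obtain ⟨w⟩ := PlacesOver.nonempty L v
  have hw : IsCMField.complexConj L • w.1 = w.1 := smul_eq_of_subsingleton_placesOver₁₀ L hv w
  have hc1 : IsCMField.complexConj L ≠ 1 := IsCMField.complexConj_ne_one L
  haveI : Subsingleton (PlacesOver L v) := hv
  letI : Unique (PlacesOver L v) := uniqueOfSubsingleton w
  -- the evaluation isomorphism `π : L_v ≃+* L_w` and the norm-one sequence of ★ `exists_normOne_seq`, read in `L_v`
  let π : LocalRing L v ≃+* w.1.adicCompletion L := RingEquiv.piUnique fun w' : PlacesOver L v => w'.1.adicCompletion L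
  have hπ : ∀ y : LocalRing L v, π y = y w := fun _ => rfl
  have hσπ : ∀ y : LocalRing L v, π (conjLocal L (IsCMField.complexConj L) v y) = galAdicCompletionMap (L := L) (IsCMField.complexConj L) hw (π y) :=
    fun y => by rw [hπ, hπ]; exact conjLocal_apply_eq_of_smul_eq (IsCMField.complexConj L) hc1 v w hw y
  have hπsc : Continuous π.symm := by
    have h := (Homeomorph.piUnique fun w' : PlacesOver L v => w'.1.adicCompletion L).symm.continuous
    exact h
  obtain ⟨useq, hu1, huval, hulim⟩ := exists_normOne_seq L v w hw hunr
  have hz1 : ∀ N, conjLocal L (IsCMField.complexConj L) v (π.symm (useq N)) * π.symm (useq N) = 1 := fun N => by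
    apply π.injective
    rw [map_mul, hσπ, RingEquiv.apply_symm_apply, map_one]
    exact hu1 N
  have hz1' : ∀ N, π.symm (useq N) * conjLocal L (IsCMField.complexConj L) v (π.symm (useq N)) = 1 := fun N => by
    rw [mul_comm]; exact hz1 N
  have hzlim : Tendsto (fun N => π.symm (useq N)) atTop (𝓝 1) := by
    have h := (hπsc.tendsto 1).comp hulim
    rw [map_one] at h
    exact h
  have hσzlim : Tendsto (fun N => conjLocal L (IsCMField.complexConj L) v (π.symm (useq N))) atTop (𝓝 1) := by
    have hσu : ∀ N, galAdicCompletionMap (L := L) (IsCMField.complexConj L) hw (useq N) = (useq N)⁻¹ := fun N =>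
      eq_inv_of_mul_eq_one_left (hu1 N)
    have hinv : Tendsto (fun N => (useq N)⁻¹) atTop (𝓝 1) := by simpa using hulim.inv₀ one_ne_zero
    have h := (hπsc.tendsto 1).comp hinv
    rw [map_one] at h
    refine h.congr fun N => ?_
    show π.symm ((useq N)⁻¹) = conjLocal L (IsCMField.complexConj L) v (π.symm (useq N))
    apply π.injective
    rw [RingEquiv.apply_symm_apply, hσπ, RingEquiv.apply_symm_apply, hσu]
  have hzne : ∀ N, 1 ≤ N → π.symm (useq N) ≠ 1 := fun N hN h => by
    have hu : useq N = 1 := by rw [← π.apply_symm_apply (useq N), h, map_one]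
    have hval := huval N hN
    rw [hu, sub_self, map_zero, map_pow, Liu2021.LemD1IndexedNonVacuityInertCofinite.valued_toPlace_uniformizer_of_isUnramifiedIn L v hunr w] at hval
    exact pow_ne_zero N WithZero.exp_ne_zero hval.symm
  -- the curve `N ↦ (P diag(z_N, 1) P⁻¹, 1) ∈ Z(t₀)` tends to `1`
  have hS := tendsto_conj_glDiagonal_two P hz1' hz1 hzlim hσzlim
  have hc : Tendsto (fun N => (⟨(((⟨P * glDiagonal 2 (LocalRing L v)
        ![(⟨π.symm (useq N), conjLocal L (IsCMField.complexConj L) v (π.symm (useq N)), hz1' N, hz1 N⟩ : (LocalRing L v)ˣ), 1] * P⁻¹,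
        conj_glDiagonal_normOne_mem_local L v w hw t₀ P d ht₀ hP hd1 (hz1 N) (hz1' N)⟩ : ((cmDatum L 2 (Matrix.of fun i j : Fin 2 => if i.val + j.val + 1 = 2 then (1 : L) else 0)).Local v)), (1 : ((cmDatum L 1 (Matrix.of fun i j : Fin 1 => if i.val + j.val + 1 = 1 then (1 : L) else 0)).Local v))) : ((cmDatum L 2 (Matrix.of fun i j : Fin 2 => if i.val + j.val + 1 = 2 then (1 : L) else 0)).Local v × (cmDatum L 1 (Matrix.of fun i j : Fin 1 => if i.val + j.val + 1 = 1 then (1 : L) else 0)).Local v)),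
        conj_glDiagonal_normOne_mem_centralizer L v w hw t₀ P d ht₀ hP hd1 (hz1 N) (hz1' N)⟩ : ↥(Subgroup.centralizer ({t₀} : Set ((cmDatum L 2 (Matrix.of fun i j : Fin 2 => if i.val + j.val + 1 = 2 then (1 : L) else 0)).Local v × (cmDatum L 1 (Matrix.of fun i j : Fin 1 => if i.val + j.val + 1 = 1 then (1 : L) else 0)).Local v))))) atTop (𝓝 1) := by
    rw [tendsto_subtype_rng]
    show Tendsto (fun N => (((⟨P * glDiagonal 2 (LocalRing L v)
        ![(⟨π.symm (useq N), conjLocal L (IsCMField.complexConj L) v (π.symm (useq N)), hz1' N, hz1 N⟩ : (LocalRing L v)ˣ), 1] * P⁻¹,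
        conj_glDiagonal_normOne_mem_local L v w hw t₀ P d ht₀ hP hd1 (hz1 N) (hz1' N)⟩ : ((cmDatum L 2 (Matrix.of fun i j : Fin 2 => if i.val + j.val + 1 = 2 then (1 : L) else 0)).Local v)), (1 : ((cmDatum L 1 (Matrix.of fun i j : Fin 1 => if i.val + j.val + 1 = 1 then (1 : L) else 0)).Local v))) : ((cmDatum L 2 (Matrix.of fun i j : Fin 2 => if i.val + j.val + 1 = 2 then (1 : L) else 0)).Local v × (cmDatum L 1 (Matrix.of fun i j : Fin 1 => if i.val + j.val + 1 = 1 then (1 : L) else 0)).Local v))) atTop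
      (𝓝 ((1 : ((cmDatum L 2 (Matrix.of fun i j : Fin 2 => if i.val + j.val + 1 = 2 then (1 : L) else 0)).Local v)), (1 : ((cmDatum L 1 (Matrix.of fun i j : Fin 1 => if i.val + j.val + 1 = 1 then (1 : L) else 0)).Local v))))
    refine Filter.Tendsto.prodMk_nhds ?_ tendsto_const_nhds
    show Tendsto (fun N => (⟨P * glDiagonal 2 (LocalRing L v)
        ![(⟨π.symm (useq N), conjLocal L (IsCMField.complexConj L) v (π.symm (useq N)), hz1' N, hz1 N⟩ : (LocalRing L v)ˣ), 1] * P⁻¹,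
        conj_glDiagonal_normOne_mem_local L v w hw t₀ P d ht₀ hP hd1 (hz1 N) (hz1' N)⟩ : ↥(«local» L (IsCMField.complexConj L) 2 (Matrix.of fun i j : Fin 2 => if i.val + j.val + 1 = 2 then (1 : L) else 0) v))) atTop (𝓝 (1 : ↥(«local» L (IsCMField.complexConj L) 2 (Matrix.of fun i j : Fin 2 => if i.val + j.val + 1 = 2 then (1 : L) else 0) v)))
    exact tendsto_subtype_rng.2 hS
  -- density: a regular `x` is in the set; a singular `x` is the limit of the regular `x · c_N`
  intro x
  by_cases hx : IsRegularElt (((x : ↥(Subgroup.centralizer ({t₀} : Set ((cmDatum L 2 (Matrix.of fun i j : Fin 2 => if i.val + j.val + 1 = 2 then (1 : L) else 0)).Local v × (cmDatum L 1 (Matrix.of fun i j : Fin 1 => if i.val + j.val + 1 = 1 then (1 : L) else 0)).Local v)))) : ((cmDatum L 2 (Matrix.of fun i j : Fin 2 => if i.val + j.val + 1 = 2 then (1 : L) else 0)).Local v × (cmDatum L 1 (Matrix.of fun i j : Fin 1 => if i.val + j.val + 1 = 1 then (1 : L) else 0)).Local v)).1.val : GL (Fin 2) (LocalRing L v))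
  · exact subset_closure hx
  have hxc := (tendsto_const_nhds (x := x)).mul hc
  rw [mul_one] at hxc
  refine mem_closure_of_tendsto hxc (Filter.eventually_atTop.2 ⟨1, fun N hN => ?_⟩)
  exact isRegularElt_mul_conj_glDiagonal_of_not_isRegularElt L v w hw t₀ P d ht₀ hP hd1 (hz1 N) (hz1' N) (hzne N hN) x hx

end Density

end Literature.NumberTheory.Rogawski1990

end
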